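import Summits.FinalStateConjecture.FinalStateConjecture.Theses.PhaseMixingCapture
import Summits.FinalStateConjecture.FinalStateConjecture.Theorems.WeakCosmicCensorshipMGHD.Negative.ConstraintsLoadBearing
import Summits.FinalStateConjecture.FinalStateConjecture.Theorems.WeakCosmicCensorshipMGHD.Negative.LoadBearing
import Summits.FinalStateConjecture.FinalStateConjecture.Theorems.WeakCosmicCensorshipMGHD.Negative.TruncatedMinkowski
import Literature.Geometry.Lorentzian.TrivialDataAdmissible
import Literature.Geometry.Lorentzian.TameGenericityLocal
import Literature.Geometry.Lorentzian.TameGenericityDiagonal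
import Literature.Geometry.Lorentzian.TameBreathingCurve
import Literature.Geometry.Lorentzian.StronglyAsymptoticallyFlatADMEnergy

/-!
# Disproof of `WeakCosmicCensorshipTame` — findings (cdisprove seat, crux
`stmt-FinalStateConjecture-17269`, route `PhaseMixingCapture`, rank 5) — cycle 1 (2026-08-17)

**Verdict of cycle 1: the crux RESISTS; no refutation.** `WeakCosmicCensorshipTame` (`W`) is, for
every connected Hausdorff second-countable smooth `3`-manifold `Σ`, TAME Christodoulou-genericity
(codimension `≥ 1`; witness curves jointly smooth, on ONE fixed sole asymptotically flat end `e`,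
every member strongly asymptotically flat (Dafermos–Rodnianski rates) on `e` with a continuous mass
function, continuous at `c = 0` in the weighted `C²₋₁ × C¹₋₂` distance `e.wDist`, injective,
immersed at `c = 0`) inside `admissibleVacuumData Σ` of the property "an MGHD exists and every MGHD
has complete `𝓘⁺` (sojourn form)". It is the first conjunct-structure of the re-typed summit. Its
ONLY delta against the pre-revision crux `WeakCosmicCensorshipMGHD` (stmt-9952; standing disproof
`Cruxes/WeakCosmicCensorshipMGHD/Disproof.lean`, whose §§1–15 are cited below as `MGHD-D§n`) is
`IsChristodoulouGeneric ↦ IsTameChristodoulouGeneric`; since tame genericity forgets to plain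
genericity, `W → WeakCosmicCensorshipMGHD` (landed:
`Theorems/PhaseMixingCaptureCaptureSufficesC2DiagonalReduction.weakCosmicCensorshipMGHD_of_tameCensorship`)
and EVERY `¬`-direction finding on the old crux transfers verbatim (§2, §3 below). What the re-type
changes is the POSITIVE side: the burial / rescaling witness families that made the old crux
"expected TRUE for the wrong reason" (MGHD-D§9, §15) are no longer admissible witnesses — §4 below
makes this a kernel-checked theorem (a tame family cannot change the mass discontinuously:
`2·|M − M'| ≤ e.wDist D D'`). With burial gone, `W` is weak cosmic censorship for one-ended
asymptotically flat vacuum data in Christodoulou's positive-(tame-)codimension formulation plus the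
Choquet-Bruhat–Geroch existence clause: OPEN in both directions outside spherical symmetry.

## What this file establishes (all `sorry`-free; prose only in docstrings)

LANDED in the tree this cycle (ACCEPTED; ideators / planners / provers may `import` them):
`Theorems/WeakCosmicCensorshipTame/Negative/TameMassContinuity.lean` (p133648: §4 — the `wDist`
mass inequality, mass continuity along tame families, burial not tame) and
`Theorems/WeakCosmicCensorshipTame/Negative/LoadBearing.lean` (p133671: §1 refutation shape for an
arbitrary property, §3 (a)–(d)). This workfile keeps inline copies (namespaced here) so that it
elaborates independently of the build state of those modules.

* §1 READ-BACK AND REFUTATION SHAPE. `wccTame_iff` (`Iff.rfl`: the crux is tame genericity of the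
  set `censored Σ`); `not_isTameGeneric_censored_iff` (exact shape of a failure on one `Σ`: an
  admissible exceptional datum `d` such that EVERY tame, immersed, injective curve of admissible data
  through `d` meets the exceptional set at some `c ≠ 0`); `not_wccTame_of_trapped` (one such `Σ, d`
  kills `W`); `not_wccTame_of_locallyTrapped` (it suffices to trap the SMALL parameters of every such
  curve: by `isTameChristodoulouGeneric_of_local` avoidance is local, so trapping must be too);
  `not_wccTame_of_forall_not_censored` (a nonempty admissible class all of whose members are
  exceptional kills `W` — the tame witness notion being inhabited through every admissible datum,
  `exists_tame_selfWitness`, is NOT needed for this: the base point alone is trapped).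
* §2 LATTICE. `not_finalStateConjecture_of_not_wccTame` (a kill here kills the summit as typed —
  hand the witness to the negative side); `not_wccTame_of_not_wccMGHD` (a kill of the pre-revision
  crux kills this one: refuting `W` is at most as hard as refuting stmt-9952, because a refuter now
  only has to trap TAME curves).
* §3 LOAD-BEARING HYPOTHESES (transfer + new).
  (a) `wccTame_false_without_constraints` — the crux with the vacuum-constraint clause deleted from
  admissibility is FALSE (one line from the landed `wcc_false_without_constraints`, MGHD-D§11: the
  constraint-violating complete AF datum `bumpData` traps every jointly smooth curve, a fortiori
  every tame one).
  (b) `trivialData_not_censoredEvery`, `wccTame_false_without_isMaximal_of` — with `IsMaximal`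
  dropped from the `∀`-clause the trivial datum is exceptional (time-truncated Minkowski, landed
  `Negative/TruncatedMinkowski.lean`, MGHD-D§8), and the whole statement is false MODULO the
  unconstructed (true) fact `H_trunc`: every admissible datum on `ℝ³` has SOME vacuum Cauchy
  development with incomplete `𝓘⁺` (local existence + time truncation; the tree has no local
  existence theorem, MGHD-D§3).
  (c) `wccTameWithoutT2_false_of` — `[T2Space Σ]` is load-bearing for the same degenerate reason as
  before (transfer of `wccWithoutT2_false_of`, MGHD-D§4(b)).
  (d) `isTameChristodoulouGeneric_admissible_zero` — with codimension parameter `0` in place of `1`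
  the crux holds outright on every `Σ` for EVERY property (constant families are tame on the sole
  end granted by admissibility; immersion and escape are vacuous over `ℝ⁰`): all content sits at
  `m = 1`. (e) `isTameChristodoulouGeneric_censored_of_forall` — dropping genericity ("every
  admissible datum is censored") is STRONGER; its expected falsity (vacuum naked singularities,
  Rodnianski–Shlapentokh-Rothman arXiv:1912.08478, Shlapentokh-Rothman arXiv:2204.09891) is not
  formalisable here and is not even printed in the SMOOTH admissible class: arXiv:2204.09891,
  p. 6, Remark 1.2 (read this cycle, `lit read`): "The spacetime produced by Theorem 1.3 does not
  arise from smooth characteristic data … The only singular behavior is in the null direction where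
  the metric is `C^{1,s}`" — so no exceptional ADMISSIBLE (smooth) datum is in print at all.
* §4 THE NEW LOAD-BEARING NOTION, TAMENESS: WHAT IT EXCLUDES (new theorems, the kernel-checked form
  of the planner's "burial / rescaling witness families are unavailable").
  `ofReal_two_mul_abs_sub_le_wDist` — for data `D`, `D'` strongly asymptotically flat on the same
  end `e` with masses `M`, `M'`: `ENNReal.ofReal (2 * |M - M'|) ≤ e.wDist D D'` (the leading terms
  differ by `2(M − M')/r · δ`, weighted by `r`; the remainders are `o(r⁻¹)`);
  `mass_unique` (`D = D'`: the mass parameter of an end is unique — also a corollary of the tree's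
  `IsStronglyAsymptoticallyFlatDR.admEnergy_eq`); `tendsto_mass_of_tendsto_wDist` — along ANY family
  continuous at `0` in `e.wDist`, EVERY admissible mass assignment is continuous at `0`;
  `tendsto_mass_of_isTameDataFamily`, `tendsto_admEnergy_of_isTameDataFamily` — in particular along a tame
  family the ADM energy is continuous at the base parameter, whether or not the family's own mass
  function is used; `isTameDataFamily_iff_admEnergy` — normal form: the mass clause of tameness IS
  "members SAF on `e` + ADM energy continuous in `c`"; `not_isTameDataFamily_of_mass_jump` — a family of SAF data whose masses do not
  tend to the base mass (burial: `M(c) → ∞`; rescaling: `M(c) = λ(c) M(0)` with `λ ↛ 1`) is NOT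
  tame, on any end, whatever else it does. Consequences recorded in the §4 docstrings: the explicit
  clause `Continuous M` of `IsTameDataFamily` is REDUNDANT AT THE BASE POINT (continuity at `0` is
  forced by `wDist → 0`) but not globally (a jointly smooth family may re-choose its far field at
  every `c ≠ 0`); what tameness does NOT exclude is recorded too (§4, remark `recedingCutoff`):
  modifications receding to infinity that are SMALL in the weighted norm — e.g. cutting a DR datum
  off to its model tail beyond radius `1/|c|` — remain continuous at `0` in `wDist` precisely
  because the DR class is a little-`o` class; such families carry vanishing energy and cannot bury
  or implode anything, so no "true for the wrong reason" line is reopened, but the typed notion is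
  still a CURVE notion, weaker than Christodoulou's straight lines `α₀ + c f` in a fixed affine
  space (a line cannot leave "unbounded support" while a receding-cutoff curve can).
* §5 `-- Targets`: none this cycle (no line picked, `stuck_stubs = []`).
* §6 WHY IT RESISTS (docblock at the end): a refutation must exhibit a smooth, complete, one-ended,
  DR-asymptotically-flat VACUUM datum whose MGHD has incomplete `𝓘⁺` in the sojourn form and which
  is STABLE under every tame immersed injective admissible curve — a tame-stable smooth vacuum naked
  singularity. Nothing of the kind is in print: vacuum naked singularities exist (RSR 2019/2023,
  non-smooth across a cone, expected NON-generic), instability of naked singularities is proved only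
  for the spherically symmetric scalar field in `BV` (Christodoulou, Ann. Math. 149; barrier
  `Literature.Barriers.FinalStateConjecture.NakedSingularityInstability` and its audit: exterior
  stability of self-similar naked singularities under smoother perturbations, Singh 2022/2024, is a
  statement about the SCALAR-FIELD model in symmetry, not about admissible vacuum data). Cheap
  handles all closed: the admissible class is inhabited (`trivialData`), the witness notion is
  inhabited through every admissible datum (breathing curves, P-invariant), `[HasLeviCivita]`
  guards are dischargeable, `IsMaximal` is a terminal-object condition in a fixed universe with
  uniqueness proved, the sojourn form has no zero-velocity or compact-`Σ` degeneracy on admissible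
  data (sole AF end ⇒ `Σ` non-compact), MGHD existence is the vendored CBG fact. No small or finite
  model of the statement exists (every instance quantifies over all vacuum Cauchy developments of a
  datum); `decide`/`simp`/`aesop` have nothing to act on.
-/

noncomputable section

-- the doubled `FinalStateConjecture.FinalStateConjecture` path component trips dupNamespace
set_option linter.dupNamespace false
-- instance search through nested operator types `E3 →L[ℝ] E3 →L[ℝ] ℝ` (as in the tree's
-- coordinate-calculus files)
set_option maxSynthPendingDepth 3

open Bundle TopologicalSpace Set Function Filter Metric Asymptotics
open scoped Manifold ContDiff Topology ENNReal

namespace Summit.FinalStateConjecture.FinalStateConjecture.Cruxes.WeakCosmicCensorshipTame.Disproof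

open Literature.Geometry.Lorentzian
open Literature.Geometry.Lorentzian.InitialDataSet
  (IsTameDataFamily IsImmersedAtZero IsTameChristodoulouGeneric HasTameCodimAtLeastIn
    IsChristodoulouGeneric isTameChristodoulouGeneric_of_local isTameDataFamily_const
    exists_tame_selfWitness)
open Summit.FinalStateConjecture.FinalStateConjecture.Theses.PhaseMixingCapture
  (WeakCosmicCensorshipTame WeakCosmicCensorshipMGHD)
open Summit.FinalStateConjecture.FinalStateConjecture.Theorems.WeakCosmicCensorshipMGHD.Negative
  (admissibleNoConstraint wcc_false_without_constraints wccWithoutT2_false_of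
    exists_vacuumCauchyDevelopment_trivialData_not_complete)

/-! ## §1 Read-back: the censored property; the crux unfolded; the shape of a refutation -/

section Sigma

variable (X : Type) [TopologicalSpace X] [ChartedSpace E3 X] [IsManifold (𝓡 3) ∞ X]
  [ConnectedSpace X]

/-- The property bundled by `WeakCosmicCensorshipTame`, verbatim: a maximal vacuum Cauchy
development (MGHD) exists, and every MGHD has complete future null infinity (sojourn form,
`Summit.FinalStateConjecture.HasCompleteNullInfinity`). -/
def censored (D : InitialDataSet (𝓡 3) X) : Prop :=
  (∃ 𝒟 : VacuumCauchyDevelopment D, 𝒟.IsMaximal) ∧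
    ∀ 𝒟 : VacuumCauchyDevelopment D, 𝒟.IsMaximal →
      Summit.FinalStateConjecture.HasCompleteNullInfinity 𝒟.toCauchyDevelopment

variable {X} in
/-- `d` is a **trapped exceptional datum** for the censored property: admissible, not censored, and
every tame (on some end), immersed, injective curve of admissible data through `d` has a member at
a NONZERO parameter which is not censored. This is the local obstruction a refutation of the crux
must exhibit on some `Σ`. -/
def IsTrapped (d : InitialDataSet (𝓡 3) X) : Prop :=
  d ∈ admissibleVacuumData X ∧ ¬ censored X d ∧
    ∀ (e : AFEnd X) (F : EuclideanSpace ℝ (Fin 1) → InitialDataSet (𝓡 3) X),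
      IsTameDataFamily e 1 F → IsImmersedAtZero 1 F → F 0 = d → Injective F →
        (∀ c, F c ∈ admissibleVacuumData X) → ∃ c, c ≠ 0 ∧ ¬ censored X (F c)

variable {X} in
/-- `d` is **locally trapped**: as `IsTrapped`, but the non-censored member is found at parameters
of arbitrarily small norm (`∀ ε > 0, ∃ c ≠ 0, ‖c‖ < ε ∧ ¬ censored (F c)`). -/
def IsLocallyTrapped (d : InitialDataSet (𝓡 3) X) : Prop :=
  d ∈ admissibleVacuumData X ∧ ¬ censored X d ∧
    ∀ (e : AFEnd X) (F : EuclideanSpace ℝ (Fin 1) → InitialDataSet (𝓡 3) X),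
      IsTameDataFamily e 1 F → IsImmersedAtZero 1 F → F 0 = d → Injective F →
        (∀ c, F c ∈ admissibleVacuumData X) →
          ∀ ε > (0 : ℝ), ∃ c, c ≠ 0 ∧ ‖c‖ < ε ∧ ¬ censored X (F c)

end Sigma

/-- **Read-back.** The crux is, `Σ` by `Σ`, tame Christodoulou-genericity (codimension `≥ 1`) of
the censored property inside the admissible class — by `Iff.rfl`. -/
theorem wccTame_iff :
    WeakCosmicCensorshipTame ↔
      ∀ (X : Type) [TopologicalSpace X] [ChartedSpace E3 X] [IsManifold (𝓡 3) ∞ X] [T2Space X]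
        [SecondCountableTopology X] [ConnectedSpace X],
        IsTameChristodoulouGeneric (admissibleVacuumData X) (censored X) 1 :=
  Iff.rfl

section Shape

variable {X : Type} [TopologicalSpace X] [ChartedSpace E3 X] [IsManifold (𝓡 3) ∞ X]
  [ConnectedSpace X]

/-- **Exact shape of a failure on one `Σ`.** Tame genericity of the censored property fails on `X`
iff some admissible datum is trapped (`IsTrapped`): unfolding `HasTameCodimAtLeastIn` and pushing
the negation through. -/
theorem not_isTameGeneric_censored_iff :
    ¬ IsTameChristodoulouGeneric (admissibleVacuumData X) (censored X) 1 ↔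
      ∃ d, IsTrapped (X := X) d := by
  constructor
  · intro h
    by_contra hno
    refine h fun d hd ↦ ?_
    by_contra hnoF
    refine hno ⟨d, hd.1, hd.2, fun e F hF himm h0 hinj hadm ↦ ?_⟩
    by_contra hc
    push Not at hc
    exact hnoF ⟨e, F, hF, himm, h0, hinj, hadm, fun c hc0 hmem ↦ hmem.2 (hc c hc0)⟩
  · rintro ⟨d, hd, hnc, htrap⟩ h
    obtain ⟨e, F, hF, himm, h0, hinj, hadm, hesc⟩ := h d ⟨hd, hnc⟩
    obtain ⟨c, hc0, hc⟩ := htrap e F hF himm h0 hinj hadm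
    exact hesc c hc0 ⟨hadm c, hc⟩

/-- A locally trapped datum is trapped. -/
theorem IsLocallyTrapped.isTrapped {d : InitialDataSet (𝓡 3) X} (h : IsLocallyTrapped d) :
    IsTrapped d := by
  refine ⟨h.1, h.2.1, fun e F hF himm h0 hinj hadm ↦ ?_⟩
  obtain ⟨c, hc0, -, hc⟩ := h.2.2 e F hF himm h0 hinj hadm 1 one_pos
  exact ⟨c, hc0, hc⟩

/-- **Local trapping suffices.** If some admissible exceptional datum traps the SMALL parameters of
every tame immersed injective admissible curve through it, tame genericity of the censored property
fails on `X`. (Contrapositive of `isTameChristodoulouGeneric_of_local`: since avoidance of the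
exceptional set may be demanded only for `0 < ‖c‖ < ε`, a refuter must trap arbitrarily small
parameters — and that is all it must do.) -/
theorem not_isTameGeneric_censored_of_locallyTrapped {d : InitialDataSet (𝓡 3) X}
    (h : IsLocallyTrapped d) :
    ¬ IsTameChristodoulouGeneric (admissibleVacuumData X) (censored X) 1 :=
  not_isTameGeneric_censored_iff.2 ⟨d, h.isTrapped⟩

/-- Conversely, if tame genericity of the censored property holds on `X`, then through every
admissible exceptional datum passes a tame immersed injective admissible curve censored at EVERY
small nonzero parameter — no admissible datum is locally trapped. -/
theorem not_isLocallyTrapped_of_isTameGeneric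
    (h : IsTameChristodoulouGeneric (admissibleVacuumData X) (censored X) 1)
    (d : InitialDataSet (𝓡 3) X) : ¬ IsLocallyTrapped d :=
  fun hd ↦ not_isTameGeneric_censored_of_locallyTrapped hd h

/-- **A nonempty admissible class all of whose members are exceptional kills tame genericity** on
that `Σ` (the base point of any would-be witness curve is already a member at... no: the members at
`c ≠ 0` are admissible, hence exceptional). -/
theorem not_isTameGeneric_censored_of_forall_not {d : InitialDataSet (𝓡 3) X}
    (hd : d ∈ admissibleVacuumData X) (hall : ∀ D ∈ admissibleVacuumData X, ¬ censored X D) :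
    ¬ IsTameChristodoulouGeneric (admissibleVacuumData X) (censored X) 1 := by
  refine not_isTameGeneric_censored_iff.2 ⟨d, hd, hall d hd, fun e F _ _ _ _ hadm ↦ ?_⟩
  refine ⟨EuclideanSpace.single (0 : Fin 1) (1 : ℝ), fun h0 ↦ ?_, hall _ (hadm _)⟩
  simpa using congrArg (fun c : EuclideanSpace ℝ (Fin 1) ↦ c 0) h0

end Shape

section Kill

variable (X : Type) [TopologicalSpace X] [ChartedSpace E3 X] [IsManifold (𝓡 3) ∞ X] [T2Space X]
  [SecondCountableTopology X] [ConnectedSpace X]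

/-- **One trapped admissible datum on one `Σ` refutes the crux.** -/
theorem not_wccTame_of_trapped (h : ∃ d, IsTrapped (X := X) d) : ¬ WeakCosmicCensorshipTame :=
  fun hW ↦ not_isTameGeneric_censored_iff.2 h (hW X)

/-- **One locally trapped admissible datum on one `Σ` refutes the crux.** -/
theorem not_wccTame_of_locallyTrapped {d : InitialDataSet (𝓡 3) X} (h : IsLocallyTrapped d) :
    ¬ WeakCosmicCensorshipTame :=
  not_wccTame_of_trapped X ⟨d, h.isTrapped⟩

/-- **A `Σ` with a nonempty, entirely exceptional admissible class refutes the crux** (the shape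
"weak cosmic censorship fails for EVERY admissible datum on `Σ`"). -/
theorem not_wccTame_of_forall_not_censored {d : InitialDataSet (𝓡 3) X}
    (hd : d ∈ admissibleVacuumData X) (hall : ∀ D ∈ admissibleVacuumData X, ¬ censored X D) :
    ¬ WeakCosmicCensorshipTame :=
  fun hW ↦ not_isTameGeneric_censored_of_forall_not hd hall (hW X)

end Kill

/-! ## §2 Lattice: summit ⇒ crux ⇒ pre-revision crux (contrapositives) -/

/-- **A kill of this crux kills the summit as typed**: the re-typed `FinalStateConjecture` implies
`WeakCosmicCensorshipTame` `Σ` by `Σ` (tame genericity is monotone under pointwise implication,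
`IsTameChristodoulouGeneric.mono`; landed positively as
`tameCensorship_of_finalStateConjecture`). -/
theorem not_finalStateConjecture_of_not_wccTame (h : ¬ WeakCosmicCensorshipTame) :
    ¬ _root_.FinalStateConjecture := by
  intro hS
  refine h fun X _ _ _ _ _ _ ↦ ?_
  exact (hS X).mono fun D _ hP ↦ ⟨hP.1, fun 𝒟 h𝒟 ↦ (hP.2 𝒟 h𝒟).1⟩

/-- **A kill of the pre-revision crux kills this one**: `WeakCosmicCensorshipTame` implies
`WeakCosmicCensorshipMGHD` (tame genericity forgets to plain genericity; landed positively as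
`weakCosmicCensorshipMGHD_of_tameCensorship`). Every `¬`-direction finding of the standing disproof
of stmt-9952 therefore applies verbatim; a refuter of the tame crux has to trap FEWER curves. -/
theorem not_wccTame_of_not_wccMGHD (h : ¬ WeakCosmicCensorshipMGHD) : ¬ WeakCosmicCensorshipTame := by
  intro hW
  refine h fun X _ _ _ _ _ _ ↦ ?_
  exact (hW X).isChristodoulouGeneric

/-! ## §3 Load-bearing hypotheses -/

/-- **(a) The vacuum-constraint clause of admissibility is load-bearing: without it the TAME crux
is false.** Statement in the conclusion: the crux with `admissibleVacuumData X` replaced by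
`admissibleNoConstraint X` (constraints deleted, everything else verbatim). One line from the landed
`wcc_false_without_constraints` (the constraint-violating complete AF datum `bumpData` on `ℝ³` traps
every jointly smooth curve through it — the Hamiltonian constraint function at the origin is
continuous in the parameter with value `6` — a fortiori every tame one). [cite: Christodoulou1999, p. A24] -/
theorem wccTame_false_without_constraints :
    ¬ ∀ (X : Type) [TopologicalSpace X] [ChartedSpace E3 X] [IsManifold (𝓡 3) ∞ X] [T2Space X]
      [SecondCountableTopology X] [ConnectedSpace X],
      IsTameChristodoulouGeneric (admissibleNoConstraint X) (censored X) 1 :=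
  fun h ↦ wcc_false_without_constraints fun X _ _ _ _ _ _ ↦ (h X).isChristodoulouGeneric

section Maximal

variable (X : Type) [TopologicalSpace X] [ChartedSpace E3 X] [IsManifold (𝓡 3) ∞ X]
  [ConnectedSpace X]

/-- The censored property with `IsMaximal` dropped from the `∀`-clause: an MGHD exists and EVERY
vacuum Cauchy development (maximal or not) has complete `𝓘⁺`. -/
def censoredEvery (D : InitialDataSet (𝓡 3) X) : Prop :=
  (∃ 𝒟 : VacuumCauchyDevelopment D, 𝒟.IsMaximal) ∧
    ∀ 𝒟 : VacuumCauchyDevelopment D,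
      Summit.FinalStateConjecture.HasCompleteNullInfinity 𝒟.toCauchyDevelopment

end Maximal

/-- **(b) `IsMaximal` is load-bearing, step 1: the trivial datum is exceptional for
`censoredEvery`** — the time-truncated Minkowski space `{x⁰ < 1}` is a vacuum Cauchy development of
`(ℝ³, δ, 0)` with incomplete `𝓘⁺` in the sojourn form (landed `Negative/TruncatedMinkowski.lean`). -/
theorem trivialData_not_censoredEvery : ¬ censoredEvery Minkowski.slice trivialData := by
  rintro ⟨-, hall⟩
  obtain ⟨𝒟, h𝒟⟩ := exists_vacuumCauchyDevelopment_trivialData_not_complete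
  exact h𝒟 (hall 𝒟)

/-- The (true, unconstructed) fact under which (b) becomes a falsity of the whole statement: every
admissible datum on `ℝ³` has SOME vacuum Cauchy development with incomplete future null infinity —
local existence (Choquet-Bruhat 1952) followed by truncation of the development in a Cauchy time
function. The tree has no local existence theorem for the vacuum Cauchy problem
(`choquetBruhat_geroch_exists_mghd_cauchy` is a vendored named fact, not a `_holds`).
[cite: ChoquetBruhatGeroch1969CMP, p. 330] -/
def H_trunc : Prop :=
  ∀ D ∈ admissibleVacuumData Minkowski.slice, ∃ 𝒟 : VacuumCauchyDevelopment D,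
    ¬ Summit.FinalStateConjecture.HasCompleteNullInfinity 𝒟.toCauchyDevelopment

/-- **(b) `IsMaximal` is load-bearing, step 2: modulo `H_trunc` the crux with `IsMaximal` dropped
from the `∀`-clause is FALSE** — under `H_trunc` every admissible datum on `ℝ³` is exceptional for
`censoredEvery`, and the admissible class of `ℝ³` is inhabited (`trivialData`), so no curve escapes
(`not_isTameGeneric_censored_of_forall_not` pattern). -/
theorem wccTame_false_without_isMaximal_of (H : H_trunc) :
    ¬ ∀ (X : Type) [TopologicalSpace X] [ChartedSpace E3 X] [IsManifold (𝓡 3) ∞ X] [T2Space X]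
      [SecondCountableTopology X] [ConnectedSpace X],
      IsTameChristodoulouGeneric (admissibleVacuumData X) (censoredEvery X) 1 := by
  intro hW
  have hall : ∀ D ∈ admissibleVacuumData Minkowski.slice, ¬ censoredEvery Minkowski.slice D := by
    rintro D hD ⟨-, hcomplete⟩
    obtain ⟨𝒟, h𝒟⟩ := H D hD
    exact h𝒟 (hcomplete 𝒟)
  obtain ⟨e, F, -, -, -, -, hadm, hesc⟩ :=
    hW Minkowski.slice trivialData ⟨trivialData_mem_admissibleVacuumData, hall _
      trivialData_mem_admissibleVacuumData⟩
  have hc : (EuclideanSpace.single (0 : Fin 1) (1 : ℝ) : EuclideanSpace ℝ (Fin 1)) ≠ 0 := fun h0 ↦ by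
    simpa using congrArg (fun c : EuclideanSpace ℝ (Fin 1) ↦ c 0) h0
  exact hesc _ hc ⟨hadm _, hall _ (hadm _)⟩

/-- **(c) `[T2Space Σ]` is load-bearing (degenerately)**: the TAME crux with `[T2Space Σ]` deleted is
false as soon as one non-Hausdorff connected second-countable `3`-manifold carries an admissible
datum (no datum on it has a vacuum Cauchy development — data embeddings land in Hausdorff
spacetimes — so every datum is exceptional). Transfer of the landed `wccWithoutT2_false_of`. -/
theorem wccTameWithoutT2_false_of
    (H : ∃ (Y : Type) (_ : TopologicalSpace Y) (_ : ChartedSpace E3 Y)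
      (_ : IsManifold (𝓡 3) ∞ Y) (_ : SecondCountableTopology Y) (_ : ConnectedSpace Y),
      ¬ T2Space Y ∧ (admissibleVacuumData Y).Nonempty) :
    ¬ ∀ (X : Type) [TopologicalSpace X] [ChartedSpace E3 X] [IsManifold (𝓡 3) ∞ X]
      [SecondCountableTopology X] [ConnectedSpace X],
      IsTameChristodoulouGeneric (admissibleVacuumData X) (censored X) 1 :=
  fun h ↦ wccWithoutT2_false_of H fun X _ _ _ _ _ ↦ (h X).isChristodoulouGeneric

section Scale

variable (X : Type) [TopologicalSpace X] [ChartedSpace E3 X] [IsManifold (𝓡 3) ∞ X]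

/-- **(d) The codimension scale: `m = 0` is trivial.** With codimension parameter `0` in place of
`1`, tame Christodoulou-genericity inside the admissible class holds for EVERY property on every `Σ`:
through an exceptional datum pass the constant `ℝ⁰`-family, tame on the sole strongly
asymptotically flat end granted by admissibility (`isTameDataFamily_const`); immersion, injectivity
and escape are vacuous over the one-point parameter space. All content of the crux sits at `m = 1`.
-/
theorem isTameChristodoulouGeneric_admissible_zero (P : InitialDataSet (𝓡 3) X → Prop) :
    IsTameChristodoulouGeneric (admissibleVacuumData X) P 0 := by
  intro d hd
  obtain ⟨-, e, M, hsole, hdecay⟩ := hd.1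
  refine ⟨e, fun _ ↦ d, isTameDataFamily_const hsole 0 hdecay, fun v hv ↦ ?_, rfl,
    fun a b _ ↦ Subsingleton.elim a b, fun _ ↦ hd.1, fun c hc ↦ ?_⟩
  · exact absurd (Subsingleton.elim v 0) hv
  · exact absurd (Subsingleton.elim c 0) hc

variable [ConnectedSpace X]

/-- **(e) Dropping genericity is a strengthening.** If EVERY admissible datum on `Σ` is censored, the
crux's `Σ`-instance holds (empty exceptional set, `isTameChristodoulouGeneric_of_forall`). The
converse direction is where the content is; the universally quantified statement is expected false
(vacuum naked singularities exist: Rodnianski–Shlapentokh-Rothman, Ann. Math. 198 (2023) =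
arXiv:1912.08478; Shlapentokh-Rothman arXiv:2204.09891) but no SMOOTH admissible exceptional datum
is in print, let alone formalisable here. -/
theorem isTameChristodoulouGeneric_censored_of_forall
    (h : ∀ D ∈ admissibleVacuumData X, censored X D) :
    IsTameChristodoulouGeneric (admissibleVacuumData X) (censored X) 1 :=
  InitialDataSet.isTameChristodoulouGeneric_of_forall h 1

end Scale

/-! ## §4 Tameness: a tame family cannot change the mass discontinuously (burial is not tame) -/

section Mass

variable {X : Type} [TopologicalSpace X] [ChartedSpace E3 X] [IsManifold (𝓡 3) ∞ X]

/-- The unit coordinate vector `e₀ ∈ ℝ³`. -/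
def e0 : E3 := EuclideanSpace.single (0 : Fin 3) (1 : ℝ)

@[simp] theorem norm_e0 : ‖e0‖ = 1 := by simp [e0]

theorem innerSL_e0_e0 : (innerSL ℝ (E := E3) : E3 →L[ℝ] E3 →L[ℝ] ℝ) e0 e0 = 1 := by
  rw [innerSL_apply_apply, real_inner_self_eq_norm_sq, norm_e0, one_pow]

/-- The `m = 0` term of `e.wDist D D'` at a point `x` beyond the inner radius bounds `wDist` from
below: `‖x‖ · ‖hCoeff e D x − hCoeff e D' x‖ ≤ e.wDist D D'`. -/
theorem ofReal_norm_mul_norm_sub_le_wDist (e : AFEnd X) (D D' : InitialDataSet (𝓡 3) X) {x : E3}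
    (hx : e.R < ‖x‖) :
    ENNReal.ofReal (‖x‖ * ‖AFEnd.hCoeff e D x - AFEnd.hCoeff e D' x‖) ≤ e.wDist D D' := by
  unfold AFEnd.wDist
  refine le_trans ?_ le_self_add
  refine le_trans ?_ (le_iSup₂_of_le (f := fun (m : ℕ) (_ : m ≤ 2) ↦ ⨆ (x : E3) (_ : e.R < ‖x‖),
    ENNReal.ofReal (‖x‖ ^ (1 + m)) *
      ‖iteratedFDeriv ℝ m (fun y ↦ AFEnd.hCoeff e D y - AFEnd.hCoeff e D' y) x‖ₑ) 0 (by norm_num)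
    le_rfl)
  refine le_trans ?_ (le_iSup₂_of_le (f := fun (x : E3) (_ : e.R < ‖x‖) ↦
    ENNReal.ofReal (‖x‖ ^ (1 + 0)) *
      ‖iteratedFDeriv ℝ 0 (fun y ↦ AFEnd.hCoeff e D y - AFEnd.hCoeff e D' y) x‖ₑ) x hx le_rfl)
  rw [← ofReal_norm, norm_iteratedFDeriv_zero, ENNReal.ofReal_mul (norm_nonneg _)]
  simp

/-- **Two data sets strongly asymptotically flat on the same end are at weighted distance at least
twice the difference of their masses**: `2 · |M − M'| ≤ e.wDist D D'`. In the chart of `e`,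
`hCoeff D − hCoeff D' = 2(M − M')/r · δ + (o(r⁻¹) − o(r⁻¹))`; evaluating on the unit vector `e₀`
and weighting by `r` gives `2|M − M'| ≤ r ‖hCoeff D − hCoeff D'‖ + r(‖rem_D‖ + ‖rem_{D'}‖)`, whose
last term is eventually `≤ ε`. Dafermos–Rodnianski, arXiv:0811.0354, App. B.2.3 (the weights);
Christodoulou, CQG 16 (1999), p. A24 (fixed asymptotics in `𝓐`). [cite: DafermosRodnianski2013, App. B.2.3] -/
theorem ofReal_two_mul_abs_sub_le_wDist (e : AFEnd X) {D D' : InitialDataSet (𝓡 3) X} {M M' : ℝ}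
    (hD : e.IsStronglyAsymptoticallyFlatDR D M) (hD' : e.IsStronglyAsymptoticallyFlatDR D' M') :
    ENNReal.ofReal (2 * |M - M'|) ≤ e.wDist D D' := by
  -- the remainders `rem_D = hCoeff D − (1 + 2M/r) δ`, `rem_{D'}` are `o(r⁻¹)` in `C⁰`
  set δ : E3 →L[ℝ] E3 →L[ℝ] ℝ := innerSL ℝ (E := E3) with hδ
  set f : E3 → E3 →L[ℝ] E3 →L[ℝ] ℝ := fun y ↦ AFEnd.hCoeff e D y - (1 + 2 * M / ‖y‖) • δ with hf
  set f' : E3 → E3 →L[ℝ] E3 →L[ℝ] ℝ := fun y ↦ AFEnd.hCoeff e D' y - (1 + 2 * M' / ‖y‖) • δ with hf'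
  have hof : (fun x ↦ ‖f x‖) =o[Bornology.cobounded E3] fun x ↦ ‖x‖ ^ (-1 : ℝ) := by
    have h := hD.1 0 (by norm_num)
    simp only [Nat.cast_zero, sub_zero, norm_iteratedFDeriv_zero] at h
    exact h
  have hof' : (fun x ↦ ‖f' x‖) =o[Bornology.cobounded E3] fun x ↦ ‖x‖ ^ (-1 : ℝ) := by
    have h := hD'.1 0 (by norm_num)
    simp only [Nat.cast_zero, sub_zero, norm_iteratedFDeriv_zero] at h
    exact h
  refine ENNReal.le_of_forall_pos_le_add fun ε hε _ ↦ ?_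
  have hε2 : (0 : ℝ) < ε / 2 := by positivity
  -- a point far out where both remainders are small and the chart is defined
  have hev : ∀ᶠ x in Bornology.cobounded E3,
      ‖‖f x‖‖ ≤ ε / 2 * ‖‖x‖ ^ (-1 : ℝ)‖ ∧ ‖‖f' x‖‖ ≤ ε / 2 * ‖‖x‖ ^ (-1 : ℝ)‖ ∧ e.R + 1 ≤ ‖x‖ :=
    ((hof.def hε2).and (hof'.def hε2)).and (eventually_cobounded_le_norm (E := E3) (e.R + 1))
      |>.mono fun x h ↦ ⟨h.1.1, h.1.2, h.2⟩
  obtain ⟨x, hx₁, hx₂, hx₃⟩ := hev.exists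
  have hxR : e.R < ‖x‖ := by linarith
  have hx0 : 0 < ‖x‖ := e.R_pos.trans hxR
  have hrpow : ‖x‖ ^ (-1 : ℝ) = ‖x‖⁻¹ := Real.rpow_neg_one ‖x‖
  rw [norm_norm, hrpow, Real.norm_of_nonneg (inv_nonneg.2 hx0.le)] at hx₁ hx₂
  have hb₁ : ‖x‖ * ‖f x‖ ≤ ε / 2 := by
    calc ‖x‖ * ‖f x‖ ≤ ‖x‖ * (ε / 2 * ‖x‖⁻¹) := mul_le_mul_of_nonneg_left hx₁ hx0.le
      _ = ε / 2 := by field_simp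
  have hb₂ : ‖x‖ * ‖f' x‖ ≤ ε / 2 := by
    calc ‖x‖ * ‖f' x‖ ≤ ‖x‖ * (ε / 2 * ‖x‖⁻¹) := mul_le_mul_of_nonneg_left hx₂ hx0.le
      _ = ε / 2 := by field_simp
  -- the algebraic identity `hCoeff D − hCoeff D' = f − f' + (2(M − M')/r) δ`, evaluated on `(e₀, e₀)`
  have hid : AFEnd.hCoeff e D x - AFEnd.hCoeff e D' x = f x - f' x + (2 * (M - M') / ‖x‖) • δ := by
    simp only [hf, hf']
    module
  have hδe : δ e0 e0 = 1 := innerSL_e0_e0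
  have heval : (2 * (M - M') / ‖x‖) =
      (AFEnd.hCoeff e D x - AFEnd.hCoeff e D' x) e0 e0 - (f x - f' x) e0 e0 := by
    rw [hid]
    simp only [_root_.add_apply, _root_.smul_apply, smul_eq_mul, hδe, mul_one]
    ring
  have hle : |2 * (M - M') / ‖x‖| ≤ ‖AFEnd.hCoeff e D x - AFEnd.hCoeff e D' x‖ + (‖f x‖ + ‖f' x‖) := by
    rw [heval]
    refine (abs_sub _ _).trans (add_le_add ?_ ?_)
    · have h := (AFEnd.hCoeff e D x - AFEnd.hCoeff e D' x).le_opNorm₂ e0 e0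
      rw [Real.norm_eq_abs, norm_e0, mul_one, mul_one] at h
      exact h
    · rw [_root_.sub_apply, _root_.sub_apply]
      refine (abs_sub _ _).trans (add_le_add ?_ ?_)
      · have h := (f x).le_opNorm₂ e0 e0
        rw [Real.norm_eq_abs, norm_e0, mul_one, mul_one] at h
        exact h
      · have h := (f' x).le_opNorm₂ e0 e0
        rw [Real.norm_eq_abs, norm_e0, mul_one, mul_one] at h
        exact h
  have hmain : 2 * |M - M'| ≤ ‖x‖ * ‖AFEnd.hCoeff e D x - AFEnd.hCoeff e D' x‖ + ε := by
    have h := mul_le_mul_of_nonneg_left hle hx0.le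
    rw [abs_div, abs_of_pos hx0, mul_div_cancel₀ _ hx0.ne', abs_mul, abs_two] at h
    linarith [mul_add ‖x‖ ‖AFEnd.hCoeff e D x - AFEnd.hCoeff e D' x‖ (‖f x‖ + ‖f' x‖),
      mul_add ‖x‖ ‖f x‖ ‖f' x‖]
  calc ENNReal.ofReal (2 * |M - M'|)
      ≤ ENNReal.ofReal (‖x‖ * ‖AFEnd.hCoeff e D x - AFEnd.hCoeff e D' x‖ + ε) :=
        ENNReal.ofReal_le_ofReal hmain
    _ = ENNReal.ofReal (‖x‖ * ‖AFEnd.hCoeff e D x - AFEnd.hCoeff e D' x‖) + ε := by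
        rw [ENNReal.ofReal_add (by positivity) ε.coe_nonneg, ENNReal.ofReal_coe_nnreal]
    _ ≤ e.wDist D D' + ε := by
        gcongr
        exact ofReal_norm_mul_norm_sub_le_wDist e D D' hxR

/-- **The mass parameter of a strongly asymptotically flat end is unique** (`wDist_self = 0` in the
previous lemma; equivalently both equal the ADM energy, `IsStronglyAsymptoticallyFlatDR.admEnergy_eq`).
[cite: DafermosRodnianski2013, App. B.2.3] -/
theorem mass_unique (e : AFEnd X) {D : InitialDataSet (𝓡 3) X} {M M' : ℝ}
    (hD : e.IsStronglyAsymptoticallyFlatDR D M) (hD' : e.IsStronglyAsymptoticallyFlatDR D M') :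
    M = M' := by
  rw [← hD.admEnergy_eq, hD'.admEnergy_eq]

/-- **Along a family continuous at `0` in the weighted distance of an end, EVERY admissible mass
assignment is continuous at `0`.** No smoothness, injectivity or continuity of `M` is assumed: the
masses are read off the asymptotics and squeezed by `2|M c − M 0| ≤ wDist (F c) (F 0) → 0`. -/
theorem tendsto_mass_of_tendsto_wDist (e : AFEnd X) {P : Type*} [TopologicalSpace P] [Zero P]
    {F : P → InitialDataSet (𝓡 3) X} {M : P → ℝ}
    (hM : ∀ c, e.IsStronglyAsymptoticallyFlatDR (F c) (M c))
    (hF : Tendsto (fun c ↦ e.wDist (F c) (F 0)) (𝓝 0) (𝓝 0)) :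
    Tendsto M (𝓝 0) (𝓝 (M 0)) := by
  have h1 : Tendsto (fun c ↦ ENNReal.ofReal (2 * |M c - M 0|)) (𝓝 0) (𝓝 0) :=
    tendsto_of_tendsto_of_tendsto_of_le_of_le tendsto_const_nhds hF (fun _ ↦ zero_le)
      fun c ↦ ofReal_two_mul_abs_sub_le_wDist e (hM c) (hM 0)
  have h2 : Tendsto (fun c ↦ (ENNReal.ofReal (2 * |M c - M 0|)).toReal) (𝓝 0) (𝓝 0) := by
    have h := (ENNReal.tendsto_toReal ENNReal.zero_ne_top).comp h1
    rwa [ENNReal.toReal_zero] at h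
  have h3 : Tendsto (fun c ↦ 2 * |M c - M 0|) (𝓝 0) (𝓝 0) :=
    h2.congr fun c ↦ ENNReal.toReal_ofReal (by positivity)
  have h4 : Tendsto (fun c ↦ |M c - M 0|) (𝓝 0) (𝓝 0) := by
    have h := h3.const_mul (1 / 2)
    simp only [mul_zero] at h
    exact h.congr fun c ↦ by ring
  rw [tendsto_iff_norm_sub_tendsto_zero]
  exact h4.congr fun c ↦ (Real.norm_eq_abs _).symm

variable {e : AFEnd X} {m : ℕ} {F : EuclideanSpace ℝ (Fin m) → InitialDataSet (𝓡 3) X}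

/-- **Along a TAME family every admissible mass assignment is continuous at the base parameter** —
not only the family's own (continuous by fiat) mass function. In particular the clause
`Continuous M` of `IsTameDataFamily` is redundant AT `c = 0`: continuity there is forced by
`wDist → 0`. (It is not redundant globally: joint smoothness is local on compacta, so a family may
re-choose its far field, and its mass, discontinuously at parameters `c ≠ 0`; the clause excludes
exactly those — harmless for honest witnesses, and fewer curves for a refuter to trap.) -/
theorem tendsto_mass_of_isTameDataFamily (hF : IsTameDataFamily e m F) {M : EuclideanSpace ℝ (Fin m) → ℝ}
    (hM : ∀ c, e.IsStronglyAsymptoticallyFlatDR (F c) (M c)) : Tendsto M (𝓝 0) (𝓝 (M 0)) :=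
  tendsto_mass_of_tendsto_wDist e hM hF.2.2.2

/-- **Along a tame family the ADM energy of the end is continuous at the base parameter.** -/
theorem tendsto_admEnergy_of_isTameDataFamily (hF : IsTameDataFamily e m F) :
    Tendsto (fun c ↦ e.admEnergy (F c)) (𝓝 0) (𝓝 (e.admEnergy (F 0))) := by
  obtain ⟨M, -, hM⟩ := hF.2.2.1
  have hE : ∀ c, e.admEnergy (F c) = M c := fun c ↦ (hM c).admEnergy_eq
  simp only [hE]
  exact tendsto_mass_of_isTameDataFamily hF hM

/-- **Normal form of tameness.** Since the mass parameter of an end is unique (it is the ADM energy,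
`mass_unique`), the mass clause `∃ M, Continuous M ∧ ∀ c, SAF (F c) (M c)` of `IsTameDataFamily`
reads: every member is strongly asymptotically flat on `e` for SOME mass, and the ADM energy
`c ↦ admEnergy e (F c)` is continuous on the whole parameter space. (Read together with
`tendsto_admEnergy_of_isTameDataFamily`: continuity AT `0` is already forced by the `wDist` clause;
the surplus demand is continuity of the ADM energy at parameters `c ≠ 0`.) -/
theorem isTameDataFamily_iff_admEnergy :
    IsTameDataFamily e m F ↔
      InitialDataSet.IsSmoothDataFamily m F ∧ e.IsSoleEnd ∧
        (∀ c, ∃ M, e.IsStronglyAsymptoticallyFlatDR (F c) M) ∧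
          Continuous (fun c ↦ e.admEnergy (F c)) ∧
            Tendsto (fun c ↦ e.wDist (F c) (F 0)) (𝓝 0) (𝓝 0) := by
  constructor
  · rintro ⟨hs, hsole, ⟨M, hMc, hM⟩, hw⟩
    refine ⟨hs, hsole, fun c ↦ ⟨M c, hM c⟩, ?_, hw⟩
    have hfun : (fun c ↦ e.admEnergy (F c)) = M := funext fun c ↦ (hM c).admEnergy_eq
    rwa [hfun]
  · rintro ⟨hs, hsole, hM, hE, hw⟩
    refine ⟨hs, hsole, ⟨fun c ↦ e.admEnergy (F c), hE, fun c ↦ ?_⟩, hw⟩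
    obtain ⟨M, hMc⟩ := hM c
    have hE' : e.admEnergy (F c) = M := hMc.admEnergy_eq
    simpa only [hE'] using hMc

/-- **Burial is not tame.** A family of data strongly asymptotically flat on `e` whose masses do NOT
tend to the base mass as `c → 0` — the exact-Kerr burial families of route SwallowTheDatum
(`M(c) → ∞`), any rescaling family `λ(c) · d` with `λ ↛ 1`, any family re-choosing its mass per
member — is not tame on `e`, whatever its smoothness, injectivity or immersion: the re-typed crux
does not accept it as a witness. This is the kernel-checked form of the planner's "burial /
rescaling witness families are unavailable" (route text, rank 5). [cite: Christodoulou1999, p. A24] -/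
theorem not_isTameDataFamily_of_mass_jump {M : EuclideanSpace ℝ (Fin m) → ℝ}
    (hM : ∀ c, e.IsStronglyAsymptoticallyFlatDR (F c) (M c)) (hjump : ¬ Tendsto M (𝓝 0) (𝓝 (M 0))) :
    ¬ IsTameDataFamily e m F :=
  fun hF ↦ hjump (tendsto_mass_of_isTameDataFamily hF hM)

/-- **Nor on any other end structure on which the members are strongly asymptotically flat**: if the
masses read on `e'` jump, the family is not tame on `e'`; combined with `mass_unique`, a family whose
members are SAF on a common end with jumping masses is tame on NO end on which they are all SAF.
(Tameness on an unrelated end `e` on which the members are not all SAF is excluded by definition.) -/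
theorem not_isTameDataFamily_of_mass_jump' {e' : AFEnd X} {M M' : EuclideanSpace ℝ (Fin m) → ℝ}
    (hM : ∀ c, e'.IsStronglyAsymptoticallyFlatDR (F c) (M c))
    (hM' : ∀ c, e'.IsStronglyAsymptoticallyFlatDR (F c) (M' c))
    (hjump : ¬ Tendsto M (𝓝 0) (𝓝 (M 0))) : ¬ Tendsto M' (𝓝 0) (𝓝 (M' 0)) := by
  have hMM' : M = M' := funext fun c ↦ mass_unique e' (hM c) (hM' c)
  simpa [← hMM'] using hjump

end Mass

/-! ## §4 (remark) What tameness does NOT exclude: weighted-small receding modifications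

`recedingCutoff` — informal record (no theorem claimed). Let `d = (h, k)` be DR-strongly
asymptotically flat on `e` with mass `M`, and let `d_c` agree with `d` on `{r < 1/|c|}` and with a
model tail of the SAME mass beyond `{r > 2/|c|}` (a Corvino–Schoen-type gluing, or, constraints
aside, the plain cutoff `h_c = h_M + χ(c² r²)(h − h_M)`). Then
`e.wDist d_c d ≤ sup_{r > 1/|c|} (r |h − h_M| + r² |D(h − h_M)| + r³ |D²(h − h_M)| + r² |k| + r³ |Dk|)
 + O(1) · sup_{1/|c| < r < 2/|c|} (same)` tends to `0` as `c → 0` BECAUSE the DR class is a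
little-`o` class (`h − h_M = o₂(r⁻¹)`, `k = o₁(r⁻²)`); joint smoothness holds since on every compact
set `d_c = d` for `|c|` small. So receding modifications remain available to witnesses provided they
are weighted-small — and weighted-small modifications at radius `ρ` carry ADM-energy `O(ε)` and
curvature `O(ε ρ⁻³)`: they can neither bury the datum (needs `M(c) → ∞`, §4) nor implode a trapped
surface around its core (needs focused energy `≳` core radius). Two consequences worth knowing:
(i) the typed witness notion is a CURVE notion; Christodoulou's printed families are straight lines
`α₀ + c f` in a fixed affine space `𝓐`, strictly more rigid (a line through a datum of unbounded
support cannot consist of data of bounded support off `c = 0`, a receding-cutoff curve can), so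
"tame codimension ≥ 1" is formally WEAKER than "line-codimension ≥ 1" where both make sense;
(ii) as for the plain notion (landed `Negative/GenericityComplement.lean`, MGHD-D§10), a property
and its negation can both be tame-generic on a toy class closed under receding cutoffs (bounded
support of `k` vs unbounded, inside pure-trace DR data on `ℝ³`: cut off along `χ(c²r²)`, resp. add
`c (1 + r²)⁻² δ`), so tame genericity is still not a Baire-type notion and "tame-generic censorship"
would not by itself exclude "tame-generic nakedness"; (iii) IMMERSION AND INJECTIVITY ARE COSMETIC
MODULO GAUGE (informal here; the device exists in the tree and is USED POSITIVELY by provers: the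
parametric breathing lemmas `AFEnd.contMDiff_breatheFamily_family_h/k` of
`Literature/Geometry/Lorentzian/AFEndBreathingFamily.lean` and the "pointed gauge enrichment + tame
packaging + immersion chain rule" inside the sorry-free deciding theorem `closes` of
`Theses/RobustClausewiseGenericity.lean`, route-repair 2026-08-17): given ANY tame jointly smooth
curve `G` through an exceptional `d` whose members off `0` are admissible and censored (no immersion, no injectivity: `G` may be STALLED at `0`, all
`c`-derivatives vanishing, or spiral), the curve `F c := (breathe (σ c))^*(G c)` is again tame
(compactly supported gauge, `isTameDataFamily_restrict_of_agree_off_compact` pattern), has the same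
censored members (`VacuumCauchyDevelopment.censored_comap_iff`), is immersed at `0` for all but one
breathing amplitude (`d/dc|₀ = λ 𝓛_V h_d + Ġ(0)` at the breathing centre) and is injective near `0`
(strictly monotone centre marker), hence after `exists_tameFamily_of_local` a legal witness. So for
the diffeomorphism-invariant `P` of this crux the clauses `IsImmersedAtZero` / `Injective` exclude
NOTHING: the effective witness notion is "`d` is accessible by a tame jointly smooth curve of
censored admissible data", i.e. tame path-accessibility of the exceptional datum from the censored
set — Christodoulou's non-degenerate direction `f` survives only as "non-degenerate modulo
`𝓛_V h_d`", which the typing does not ask. (No loophole for a cheap PROOF follows: accessibility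
still needs censored data converging to every naked one in the weighted-`C²` + compact-`C^∞` sense,
the density half of genericity, open in vacuum.) None of (i)–(iii) yields a witness for or against
the crux: censoring a naked singularity by a tame curve needs a COMPACTLY located
perturbation forming a trapped surface first (Christodoulou's mechanism), and trapping every tame
curve needs a tame-STABLE naked singularity.
-/

/-! ## §5 -- Targets

None this cycle: no line is picked on this crux (`PICKED.md` absent), `stuck_stubs = []`.
-/

/-! ## §6 Why the crux resists (cycle 1)

A refutation = `IsLocallyTrapped d` for one admissible `d` on one `Σ` (§1): a smooth complete
one-ended DR-asymptotically-flat solution of the vacuum constraints whose MGHD has INCOMPLETE `𝓘⁺`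
in the sojourn form (an expanding Cauchy horizon cutting the ingoing normalised rays from radius `R`
after sojourn bounded in `R`) and such that every tame immersed injective admissible curve through
it has non-censored members at arbitrarily small parameters. In print: vacuum naked singularities
exist (Rodnianski–Shlapentokh-Rothman, Ann. Math. 198 (2023); Shlapentokh-Rothman arXiv:2204.09891)
with limited regularity across the past cone of the singular point and are expected NON-generic;
positive-codimension instability is a theorem only for the spherically symmetric scalar field in
`BV` (Christodoulou, Ann. Math. 149 (1999)); in smoother classes of that MODEL the self-similar
naked singularities are exterior-stable (Singh arXiv:2210.11325, arXiv:2402.00062) — the catalogued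
barrier `Literature.Barriers.FinalStateConjecture.NakedSingularityInstability` and its narrow audit —
which concerns the scalar-field model, not admissible vacuum data, and says nothing about trapping
TAME curves (compactly located `C^∞`-small perturbations are tame). Nothing decides the generic
vacuum statement either way; the typed statement has no junk handle left (§3, §4, MGHD-D§§1–15;
rattack note 2026-08-16). Landed this cycle: `Negative/TameMassContinuity.lean` (p133648), `Negative/LoadBearing.lean` (p133671).
Provers: the door is `isTameChristodoulouGeneric_of_local` /
`isTameChristodoulouGeneric_of_relative` — genericity must be produced ALONG curves through each
exceptional datum, never by conjunction (tame genericities do not intersect, MGHD-D§10 / TameCensorship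
`GenericityAndFails`), and every witness curve must keep the mass continuous (§4).
-/

end Summit.FinalStateConjecture.FinalStateConjecture.Cruxes.WeakCosmicCensorshipTame.Disproof

end
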